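import Mathlib
import Summits.Ventures.PercRepro2.Defs
import Summits.Ventures.PercRepro2.Graph
import Summits.Ventures.PercRepro2.OneColourSwitch
import Summits.Ventures.PercRepro2.RegionHubSign
import Summits.Ventures.PercRepro2.SideSwitch
import Summits.Ventures.PercRepro2.SideSwitchFibre
import Summits.Ventures.PercRepro2.SideSwitchClosed
import Summits.Ventures.PercRepro2.SideSwitchComps
import Summits.Ventures.PercRepro2.M9NoPocketDefs
import Summits.Ventures.PercRepro2.M9NoPocketWorld
import Summits.Ventures.PercRepro2.M9NoPocketWorldD
import Summits.Ventures.PercRepro2.M9NoPocketMono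
import Summits.Ventures.PercRepro2.M9NoPocketCompl
import Summits.Ventures.PercRepro2.M9DAvoid
import Summits.Ventures.PercRepro2.M9PocketCubeDefs

/-!
# The block-group cube WITH a pocket — monotonicity of the `G − d` connections and of the hub
edges (blind cell PercRepro2, p3 g23, 2026-08-28; `proofs/P3-HARRIS.md` §3)

On the cube of a pocket representative (`x ≤ x'`: more blocks on the `B`-side, more `Y` pocket
edges, more `W` `T`-edges) the `Y`-connections of `G − d` from a vertex outside the `Y`-world
increase (`conn_endsD_assignX_mono`), the `W`-connections of `G − d` from a vertex outside the
`W`-world decrease (`conn_endsD_compl_assignX_anti`), the `Y`-hub predicate `hubY` increases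
(`hubY_assignX_mono`) and the `W`-hub predicate `hubW` decreases (`hubW_assignX_anti`).  The
tool is the **within-set transfer** `conn_of_le_within`: a connection survives in `ω'` when `ω'`
is open on every `ω`-open non-loop edge inside an `ω`-closed set containing the start; the
changed edges from `x` to `x'` touch the switched blocks (on the `A`-side at `x`, in the
`Y`-world) or are pocket edges turned from `W` to `Y`.  Own work; std axioms.
-/

namespace Summit.Ventures.PercRepro2

namespace NoPocket

open Finset Classical RegionHub OneColourSwitch SideSwitch

variable {V : Type*} {E : Type*}

section Tools

variable {ends : E → Sym2 V}

/-- **Within-set transfer**: a connection of `ω` from `a ∈ S`, `S` closed under open adjacency of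
`ω`, survives in any `ω'` that is open on every `ω`-open non-loop edge with both ends in `S`. -/
lemma conn_of_le_within {S : Set V} {ω ω' : Config E}
    (hcl : ∀ x ∈ S, ∀ y, (openGraph ends ω).Adj x y → y ∈ S)
    (h : ∀ e x y, ends e = s(x, y) → x ≠ y → x ∈ S → y ∈ S → ω e = true → ω' e = true)
    {a b : V} (ha : a ∈ S) (hc : Conn ends ω a b) : Conn ends ω' a b := by
  have key : b ∈ {x | x ∈ S ∧ Conn ends ω' a x} := by
    refine mem_of_conn_of_closed (ends := ends) (ω := ω) ?_ ⟨ha, conn_refl _ _ _⟩ hc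
    rintro x ⟨hxS, hxc⟩ y hxy
    have hyS := hcl x hxS y hxy
    obtain ⟨hne, e, he, hends⟩ := openGraph_adj.1 hxy
    exact ⟨hyS, conn_trans hxc (conn_of_openAdj ⟨e, h e x y hends hne hxS hyS he, hends⟩)⟩
  exact key.2

/-- Within-cluster transfer in `G − d`: a connection of `G − d` from `a` survives in `ω'` when
`ω'` is open on every `ω`-open edge of `G − d` (both ends `≠ d`, distinct) inside the
`G − d`-cluster of `a`. -/
lemma conn_endsD_of_le_within_cluster {d : V} {ω ω' : Config E} {a b : V}
    (h : ∀ e x y, ends e = s(x, y) → x ≠ y → x ≠ d → y ≠ d → Conn (endsD ends d) ω a x →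
      Conn (endsD ends d) ω a y → ω e = true → ω' e = true)
    (hc : Conn (endsD ends d) ω a b) : Conn (endsD ends d) ω' a b := by
  refine conn_of_le_within (ends := endsD ends d) (S := {x | Conn (endsD ends d) ω a x}) ?_ ?_
    (conn_refl _ _ _) hc
  · intro x hx y hxy
    obtain ⟨_, e, he, hends⟩ := openGraph_adj.1 hxy
    exact conn_trans hx (conn_of_openAdj ⟨e, he, hends⟩)
  · intro e x y hends hne hx hy he
    by_cases hd : d ∈ ends e
    · rw [endsD_of_mem hd, Sym2.eq_iff] at hends
      exfalso
      rcases hends with ⟨h1, h2⟩ | ⟨h1, h2⟩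
      · exact hne (h1.symm.trans h2)
      · exact hne (h2.symm.trans h1)
    · rw [endsD_of_notMem hd] at hends
      have hxd : x ≠ d := by rintro rfl; exact hd (by rw [hends]; exact Sym2.mem_mk_left _ _)
      have hyd : y ≠ d := by rintro rfl; exact hd (by rw [hends]; exact Sym2.mem_mk_right _ _)
      exact h e x y hends hne hxd hyd hx hy he

/-- A vertex of the `G − d`-cluster of a vertex outside the `Y`-world of `G − d` is outside it. -/
lemma not_mem_K2_endsD_of_conn {d r s : V} {ω : Config E} {a x : V}
    (ha : a ∉ K2 (endsD ends d) r s ω) (hc : Conn (endsD ends d) ω a x) :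
    x ∉ K2 (endsD ends d) r s ω := by
  intro hx
  apply ha
  rcases mem_K2_iff.1 hx with h | h
  · exact mem_K2_iff.2 (Or.inl (conn_trans h (conn_symm hc)))
  · exact mem_K2_iff.2 (Or.inr (conn_trans h (conn_symm hc)))

end Tools

section Mono

variable [Fintype V] [DecidableEq V] [Fintype E] [DecidableEq E]

variable {ends : E → Sym2 V}

/-- A vertex of a block switched in between lies in the `Y`-world of `G − d` of the smaller
assignment. -/
lemma mem_K2_endsD_assignX_of_mem_sdiff' {p q r s d : V} (hr : d ≠ r) (hs : d ≠ s) {ρ : Config E}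
    (hρ : ρ ∈ RepD ends p q r s d) {x x' : Finset (Finset V) × Finset E} (hxx' : x ≤ x')
    (hT' : x'.1 ⊆ blocks ends d r s ρ) (hF : x.2 ⊆ freeE ends d r s ρ) {y : V}
    (hy : y ∈ unionT x'.1 \ unionT x.1) : y ∈ K2 (endsD ends d) r s (assignX ends x ρ) := by
  obtain ⟨hyT', hyT⟩ := Finset.mem_sdiff.1 hy
  rw [K2_endsD_assignX' hr hs hρ (hxx'.1.trans hT') hF]
  exact ⟨unionT_subset_K2_endsD hρ hT' (Finset.mem_coe.2 hyT'), fun h => hyT (Finset.mem_coe.1 h)⟩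

/-- A vertex of a block switched in between lies in the `W`-world of `G − d` of the larger
assignment. -/
lemma mem_M2_endsD_assignX_of_mem_sdiff' {p q r s d : V} (hr : d ≠ r) (hs : d ≠ s) {ρ : Config E}
    (hρ : ρ ∈ RepD ends p q r s d) {x x' : Finset (Finset V) × Finset E} (_hxx' : x ≤ x')
    (hT' : x'.1 ⊆ blocks ends d r s ρ) (hF' : x'.2 ⊆ freeE ends d r s ρ) {y : V}
    (hy : y ∈ unionT x'.1 \ unionT x.1) : y ∈ M2 (endsD ends d) r s (assignX ends x' ρ) := by
  obtain ⟨hyT', _⟩ := Finset.mem_sdiff.1 hy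
  rw [M2_endsD_assignX' hr hs hρ hT' hF']
  exact Or.inr (Finset.mem_coe.2 hyT')

/-- A pocket edge not in `x.2` is `W` in the assignment of a pocket representative. -/
lemma assignX_Pk_eq_false_of_notMem {p q r s d : V} {ρ : Config E} (hρ : ρ ∈ RepP ends p q r s d)
    {x : Finset (Finset V) × Finset E} (hT : x.1 ⊆ blocks ends d r s ρ) {e : E}
    (he : e ∈ Pk ends d r s ρ) (hx : e ∉ x.2) : assignX ends x ρ e = false := by
  obtain ⟨hρD, hW⟩ := mem_RepP.1 hρ
  rw [assignX_Pk hρD hT he, if_neg hx]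
  exact hW e he

/-- A pocket edge in `x.2` is `Y` in the assignment of a pocket representative. -/
lemma assignX_Pk_eq_true_of_mem {p q r s d : V} {ρ : Config E} (hρ : ρ ∈ RepP ends p q r s d)
    {x : Finset (Finset V) × Finset E} (hT : x.1 ⊆ blocks ends d r s ρ) {e : E}
    (he : e ∈ Pk ends d r s ρ) (hx : e ∈ x.2) : assignX ends x ρ e = true := by
  obtain ⟨hρD, hW⟩ := mem_RepP.1 hρ
  rw [assignX_Pk hρD hT he, if_pos hx, hW e he]
  rfl

omit [Fintype V] in
/-- A free edge not at `d` is a pocket edge. -/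
lemma mem_Pk_of_mem_freeE_of_notMem_d {d r s : V} {ρ : Config E} {e : E}
    (he : e ∈ freeE ends d r s ρ) (hd : d ∉ ends e) : e ∈ Pk ends d r s ρ := by
  rcases mem_freeE.1 he with h | h
  · exact (hd (d_mem_of_mem_Tset h)).elim
  · exact h

/-- **(M1′) `Y`-connections of `G − d` from a vertex outside the `Y`-world increase** along the
cube. -/
theorem conn_endsD_assignX_mono {p q r s d : V} (hr : d ≠ r) (hs : d ≠ s) {ρ : Config E}
    (hρ : ρ ∈ RepP ends p q r s d) {x x' : Finset (Finset V) × Finset E} (hxx' : x ≤ x')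
    (hx : x ∈ cubeP ends d r s ρ) (hx' : x' ∈ cubeP ends d r s ρ) {a b : V}
    (ha : a ∉ K2 (endsD ends d) r s (assignX ends x ρ))
    (hc : Conn (endsD ends d) (assignX ends x ρ) a b) :
    Conn (endsD ends d) (assignX ends x' ρ) a b := by
  obtain ⟨hρD, _⟩ := mem_RepP.1 hρ
  obtain ⟨hT, hF⟩ := mem_cubeP.1 hx
  obtain ⟨hT', hF'⟩ := mem_cubeP.1 hx'
  refine conn_endsD_of_le_within_cluster ?_ hc
  intro e y z hends hyz hyd hzd hay haz hopen
  have hyK : y ∉ K2 (endsD ends d) r s (assignX ends x ρ) := not_mem_K2_endsD_of_conn ha hay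
  have hzK : z ∉ K2 (endsD ends d) r s (assignX ends x ρ) := not_mem_K2_endsD_of_conn ha haz
  have hd : d ∉ ends e := notMem_of_ends_ne hends hyd hzd
  rw [← assignX_eq_of_le hxx' hT' ?_ ?_]
  · exact hopen
  · rintro ⟨w, hw, v, hwv⟩
    rw [hends, Sym2.eq_iff] at hwv
    rcases hwv with ⟨h1, _⟩ | ⟨_, h2⟩
    · rw [← h1] at hw
      exact hyK (mem_K2_endsD_assignX_of_mem_sdiff' hr hs hρD hxx' hT' hF (Finset.mem_coe.1 hw))
    · rw [← h2] at hw
      exact hzK (mem_K2_endsD_assignX_of_mem_sdiff' hr hs hρD hxx' hT' hF (Finset.mem_coe.1 hw))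
  · intro heF
    obtain ⟨heF', hex⟩ := Finset.mem_sdiff.1 heF
    have hP : e ∈ Pk ends d r s ρ := mem_Pk_of_mem_freeE_of_notMem_d (hF' heF') hd
    rw [assignX_Pk_eq_false_of_notMem hρ hT hP hex] at hopen
    exact Bool.false_ne_true hopen

/-- **(M1″) `W`-connections of `G − d` from a vertex outside the `W`-world decrease** along the
cube. -/
theorem conn_endsD_compl_assignX_anti {p q r s d : V} (hr : d ≠ r) (hs : d ≠ s) {ρ : Config E}
    (hρ : ρ ∈ RepP ends p q r s d) {x x' : Finset (Finset V) × Finset E} (hxx' : x ≤ x')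
    (hx : x ∈ cubeP ends d r s ρ) (hx' : x' ∈ cubeP ends d r s ρ) {a b : V}
    (ha : a ∉ M2 (endsD ends d) r s (assignX ends x' ρ))
    (hc : Conn (endsD ends d) (OneColourSwitch.compl (assignX ends x' ρ)) a b) :
    Conn (endsD ends d) (OneColourSwitch.compl (assignX ends x ρ)) a b := by
  obtain ⟨hρD, _⟩ := mem_RepP.1 hρ
  obtain ⟨hT, hF⟩ := mem_cubeP.1 hx
  obtain ⟨hT', hF'⟩ := mem_cubeP.1 hx'
  refine conn_endsD_of_le_within_cluster ?_ hc
  intro e y z hends hyz hyd hzd hay haz hopen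
  have ha' : a ∉ K2 (endsD ends d) r s (OneColourSwitch.compl (assignX ends x' ρ)) := by
    rwa [K2_compl]
  have hyM : y ∉ M2 (endsD ends d) r s (assignX ends x' ρ) := by
    have := not_mem_K2_endsD_of_conn ha' hay
    rwa [K2_compl] at this
  have hzM : z ∉ M2 (endsD ends d) r s (assignX ends x' ρ) := by
    have := not_mem_K2_endsD_of_conn ha' haz
    rwa [K2_compl] at this
  have hd : d ∉ ends e := notMem_of_ends_ne hends hyd hzd
  simp only [OneColourSwitch.compl] at hopen ⊢
  rw [assignX_eq_of_le hxx' hT' ?_ ?_]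
  · exact hopen
  · rintro ⟨w, hw, v, hwv⟩
    rw [hends, Sym2.eq_iff] at hwv
    rcases hwv with ⟨h1, _⟩ | ⟨_, h2⟩
    · rw [← h1] at hw
      exact hyM (mem_M2_endsD_assignX_of_mem_sdiff' hr hs hρD hxx' hT' hF' (Finset.mem_coe.1 hw))
    · rw [← h2] at hw
      exact hzM (mem_M2_endsD_assignX_of_mem_sdiff' hr hs hρD hxx' hT' hF' (Finset.mem_coe.1 hw))
  · intro heF
    obtain ⟨heF', _⟩ := Finset.mem_sdiff.1 heF
    have hP : e ∈ Pk ends d r s ρ := mem_Pk_of_mem_freeE_of_notMem_d (hF' heF') hd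
    rw [assignX_Pk_eq_true_of_mem hρ hT' hP heF'] at hopen
    exact Bool.noConfusion hopen

end Mono

end NoPocket

end Summit.Ventures.PercRepro2
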